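import Summits.QuantumFields.BalabanUV.T4Continuum.Spine.NE1p.TiltedMeanInfluence
import Summits.QuantumFields.BalabanUV.T4Continuum.Spine.NE1p.DressedMGFFormUnitLattice

/-!
# T⁴ programme, spine estimate NE1′ (node O3b/H2) — TILT ELIMINATION: the per-slot producer input of the old-component
# influence budget is an UNTILTED, OBSERVABLE-FREE unit-lattice VISIBILITY of the slot's weight

Cell `pub-balaban-gaps` (YM blitz Y1, track G2), seat `ne1` gen 5 (prover-pub-balaban-gaps-ne1-g5-0), record `HOME/ne/NE1.md`
§4 rows R37–R39 (gen 5).  ADDITIVE — imports the seat's gen-4 `TiltedMeanInfluence` (p345768 ✓: `tiltedMean_eq_div`,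
`abs_tiltedMean_le`, `integrable_mul_exp_mul`; through it gen 3's `OldInfluenceBudget` and gen 2's `tiltedMean`) and gen 2's
`DressedMGFFormUnitLattice` (p342433 ✓: `tiltedMean_comp_eq`) ONLY; modifies nothing.  Siblings (same generation):
`TiltedMeanVisibilityCentred` (discrete periodic toy: where the second small factor of a visibility comes from; a computed visibility
ledger along a chain of slots) and `TiltedMeanVisibilityTwoRun` (NE1.md R23 (b) typed; the whole binder from an untilted law-level ledger).

WHAT THIS IS.  Gen 4 located the ONE input a NODE-O producer owes per re-sampled old slot `X` of a class law `ν`: a bound on the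
covariance `Cov_{ν_s}(F, r_X)` of the loop variable `F` with the slot's density ratio `r_X` under the TILTED class law
`ν_s = ν.tilted (sF)`, for every tilt `|s| ≤ l₀` (`TiltedMeanInfluence.influence_eq_cov_div`).  Read literally, that asks the
producer to control Bałaban's run WITH THE SOURCE INSIDE (the dressed run of NE1′, ≈ 90 pp. of transposition, NE1.md §5).  This
file shows the tilt is FREE at that socket.  The loop variable of the T⁴ programme factors through the unit lattice, `F = W ∘ π`
(`π = avg^K`, `|W| ≤ B`; gen 2 `DressedMGFFormUnitLattice`), so the tilt factor `e^{sF}` is `π`-measurable and conditioning on `π`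
replaces `r_X` by a TILT-INDEPENDENT unit-lattice weight `m_X = E_ν[r_X | π]`:
* §1 [one space] for a reference measure `μ` on `X`, `|W| ≤ B` and two measurable integrable weights `mA, mB ≥ 0` of positive mass,
  for EVERY tilt `s` and EVERY reference level `c`: `|tiltedMean W (μ.withDensity mB) s − tiltedMean W (μ.withDensity mA) s| ≤
  2B·e^{2|s|B}·(∫|mB − c·mA| dμ) ∕ (∫ mB dμ)` (`abs_tiltedMean_withDensity_sub_withDensity_le`; one weight against `μ` itself:
  `abs_tiltedMean_withDensity_sub_le`) — tilted means are Lipschitz in the LAW (L¹ ∕ total-variation distance of the normalised laws),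
  uniformly on a bounded tilt window, by the exact identity `N_B∕Z_B − N_A∕Z_A = ∫(mB − c·mA)(W − N_A∕Z_A)e^{sW}dμ ∕ Z_B`.  This is
  NE1.md R23 (b)'s law-level currency with the common dominating measure explicit (two runs' class pieces both have densities w.r.t.
  the unit-lattice Haar measure) — typed now because gen 5's point is precisely that law-level inputs absorb the tilt.
* §2 [through the unit lattice] a measurable unit-lattice version `m` of the weight EXISTS, `(ν.map π).withDensity m =
  (ν.withDensity r).map π` (`exists_unitLattice_weight`, Radon–Nikodym on `X`), it carries the mass of `r`
  (`integral_unitLattice_weight_eq`), the influence of the re-weighting on `W ∘ π` IS the influence of `m` on `W`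
  (`tiltedMean_comp_withDensity_eq`), hence THE PER-SLOT SOCKET IN TILT-FREE FORM: for every `s`, `c`,
  `|tiltedMean (W ∘ π) (ν.withDensity r) s − tiltedMean (W ∘ π) ν s| ≤ 2B·e^{2|s|B}·(∫|m − c| d(ν.map π)) ∕ (∫ r dν)`
  (`abs_influence_comp_le_visibility`); an INVISIBLE weight (a constant is a unit-lattice version: the `T4Spectator` ∕ ℝ-transparency
  case of NE1.md R4) has influence `0` (`tiltedMean_comp_withDensity_eq_of_invisible`).
* §3 [ledger] per-slot bounds `|Δ K t τ s X| ≤ Cv·vis K τ X` by a visibility ledger `vis` that knows neither `t` nor `s`, with slice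
  sums `Σ_{sc X = j} vis ≤ vol·E·a^{K−j}`, give gen 3's `OldInfluenceBudget … vol (Cv·E) a` (`oldInfluenceBudget_of_visibility`);
  `Cv = 2B·e^{2l₀B}` on the window (`visibilityConst_mono`).
* §4 [one run, slots switched on one at a time] telescoping (`tiltedMean_telescope` — the one-run half of a `ScaleLedger` by
  construction) and the chain bound: if `ν (i+1) = (ν i).withDensity (r i)` then
  `|tiltedMean (W ∘ π) (ν n) s − tiltedMean (W ∘ π) (ν 0) s| ≤ 2B·e^{2|s|B}·Σ_{i<n} vis i` (`abs_tiltedMean_chain_le_sum_visibility`).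
CONSEQUENCE FOR THE ROW (NE1.md v5 §0 l.11, R37–R39).  The old-component budget of ONE run can be PRODUCED from a statement
about the UNDRESSED run alone: per class and per old slot, the L¹-visibility from the unit lattice of switching the slot on
(`∫|E[r_X | avg^K] − c| dν ∕ ∫ r_X dν` — no observable, no source, no tilt), with slice sums geometric in the age.  The source
window `|s| ≤ l₀` and the observable enter through the constant `2B·e^{2l₀B}` only; ONE visibility ledger serves every bounded
unit-lattice observable (every loop, every product of loops) and every `l₀` at once.  In this currency the producer never runs the
tilted ∕ dressed RG: the «μ-uniform, t-analytic dressed representation» of NE1′'s original wording is a property of ONE ROUTE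
(Bałaban's, CMP 198∕199's for the N-vector model), not of the consumed estimate.  What visibility does NOT buy: the second small
factor.  `∫|m_X − c|` is first order in how far the slot is seen from the unit scale; that it is SECOND order in the loop's
UV-irrelevance rate `θ₁^{K−j}` for centred slots (conjugation symmetry, kernel `T4AdInvariant`) against a small-field class law
with bounded second differences, or first order × the flatness factor `φ^{K−j}` otherwise (NE1.md R28 (2) (β2)), is the
producer's power counting — NODE O's object and [B13] §§1–2 ∕ [B14] §2 KIND, NOT certified, NOT asserted here.

HONEST FRAMING.  [folklore] measure theory (tilted measures, `withDensity`, push-forward, Radon–Nikodym) and finite-sum bookkeeping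
over ABSTRACT data; NOTHING of Bałaban's is asserted or instantiated (which slots, which weights `r_X`, which order of switching on
realise a `ScaleLedger` for his class-conditioned laws is row NE1′'s OBJECT-bound content behind NODE O; no visibility is computed
for any lattice gauge measure).  `OldInfluenceBudget` ∕ (QL-a) is NOT IN PRINT for the d = 4 non-abelian model
([Balaban1989LargeFieldII] p. 356 defers observables).  NE1′ NOT proved; spine 0∕9; (B) 0∕13; one fixed finite T⁴ — NOT ℝ⁴, NOT
infinite volume, NOT a mass gap, NOT Clay.  0 sorry.
-/

noncomputable section

open MeasureTheory ProbabilityTheory Finset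
open scoped BigOperators NNReal ENNReal

namespace Summit.QuantumFields.BalabanUV.T4Continuum.NE1p.TiltedMeanVisibility

open Summit.QuantumFields.BalabanUV.T4Continuum.NE1p.DressedMGFForm (tiltedMean tiltedMean_comp_eq)
open Summit.QuantumFields.BalabanUV.T4Continuum.NE1p.TiltedMeanInfluence (tiltedMean_eq_div abs_tiltedMean_le
  integrable_mul_exp_mul)
open Summit.QuantumFields.BalabanUV.T4Continuum.NE1p.TiltedMeanCrossover (OldInfluenceBudget)
open Literature.MathematicalPhysics.QuantumFieldTheory.Balaban1983to89

/-! ## §1 On one space: re-weighting a law moves a tilted mean by at most `2B·e^{2|s|B}` × the L¹-visibility of the weight -/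

section OneSpace

variable {X : Type*} {mX : MeasurableSpace X} {μ : Measure X} [IsFiniteMeasure μ] {W : X → ℝ} {B : ℝ}

/-- The tilt factor of a variable bounded by `B` is at most `e^{|s|B}`. [folklore] -/
theorem exp_mul_le_exp_abs (hW : ∀ x, |W x| ≤ B) (s : ℝ) (x : X) : Real.exp (s * W x) ≤ Real.exp (|s| * B) := by
  refine Real.exp_le_exp.mpr ((le_abs_self _).trans ?_)
  rw [abs_mul]
  exact mul_le_mul_of_nonneg_left (hW x) (abs_nonneg s)

/-- … and at least `e^{−|s|B}`. [folklore] -/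
theorem exp_neg_abs_le_exp_mul (hW : ∀ x, |W x| ≤ B) (s : ℝ) (x : X) : Real.exp (-(|s| * B)) ≤ Real.exp (s * W x) := by
  refine Real.exp_le_exp.mpr ?_
  have h : |s * W x| ≤ |s| * B := by rw [abs_mul]; exact mul_le_mul_of_nonneg_left (hW x) (abs_nonneg s)
  linarith [neg_abs_le (s * W x)]

omit [IsFiniteMeasure μ] in
/-- **TWO WEIGHTS ON ONE REFERENCE LAW: TILTED MEANS ARE LIPSCHITZ IN THE LAW, UNIFORMLY ON A BOUNDED TILT WINDOW.**  `μ` ANY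
reference measure on `X` (in the application: the Haar∕product measure of the unit-lattice field space, or one run's class law),
`W` measurable with `|W| ≤ B`, `mA mB : X → ℝ≥0` measurable `μ`-integrable weights of positive mass (the two laws are
`μ.withDensity mA`, `μ.withDensity mB` — two runs' class pieces, or one class piece before∕after a slot is switched on).  Then for
EVERY tilt `s` and EVERY reference level `c ∈ ℝ`:
`|tiltedMean W (μ.withDensity mB) s − tiltedMean W (μ.withDensity mA) s| ≤ 2B·e^{2|s|B}·(∫ |mB − c·mA| dμ) ∕ (∫ mB dμ)`.
The right-hand side is UNTILTED and sees the observable ONLY through `B`; with `c = ∫mB ∕ ∫mA` it is `2B·e^{2|s|B}` × the total-variation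
distance of the two normalised laws.  Proof: with `E = e^{sW}`, `N_A = ∫mA·W·E dμ`, `Z_A = ∫mA·E dμ`, `q = N_A∕Z_A` and `N_B`, `Z_B`
likewise, the exact identity `N_B∕Z_B − q = (∫ (mB − c·mA)(W − q)E dμ) ∕ Z_B` holds for every `c` (because `N_A − q·Z_A = 0`), and
`|W − q| ≤ 2B`, `E ≤ e^{|s|B}`, `Z_B ≥ e^{−|s|B}∫mB dμ`.  This is NE1.md R23 (b)'s law-level currency with the common dominating measure
made explicit. [folklore] -/
theorem abs_tiltedMean_withDensity_sub_withDensity_le (hWm : Measurable W) (hW : ∀ x, |W x| ≤ B) {mA mB : X → ℝ≥0}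
    (hmAm : Measurable mA) (hmAi : Integrable (fun x => (mA x : ℝ)) μ) (hmA0 : 0 < ∫ x, (mA x : ℝ) ∂μ)
    (hmBm : Measurable mB) (hmBi : Integrable (fun x => (mB x : ℝ)) μ) (hmB0 : 0 < ∫ x, (mB x : ℝ) ∂μ) (s c : ℝ) :
    |tiltedMean W (μ.withDensity fun x => mB x) s - tiltedMean W (μ.withDensity fun x => mA x) s|
      ≤ 2 * B * Real.exp (2 * (|s| * B)) * (∫ x, |(mB x : ℝ) - c * mA x| ∂μ) / ∫ x, (mB x : ℝ) ∂μ := by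
  -- `μ ≠ 0`, `X` nonempty, `0 ≤ B`
  have hμ : μ ≠ 0 := by
    intro h; rw [h, integral_zero_measure] at hmB0; exact lt_irrefl _ hmB0
  obtain ⟨x₀⟩ : Nonempty X := by
    by_contra h
    haveI : IsEmpty X := not_nonempty_iff.mp h
    exact hμ (Measure.eq_zero_of_isEmpty μ)
  have hB : 0 ≤ B := (abs_nonneg _).trans (hW x₀)
  -- the tilt factor and its bounds
  set E : X → ℝ := fun x => Real.exp (s * W x) with hEdef
  have hEle : ∀ x, E x ≤ Real.exp (|s| * B) := fun x => exp_mul_le_exp_abs hW s x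
  have hEge : ∀ x, Real.exp (-(|s| * B)) ≤ E x := fun x => exp_neg_abs_le_exp_mul hW s x
  have hEpos : ∀ x, 0 < E x := fun x => Real.exp_pos _
  have hEm : Measurable E := Real.measurable_exp.comp (measurable_const.mul hWm)
  have hWEb : ∀ x, ‖W x * E x‖ ≤ B * Real.exp (|s| * B) := fun x => by
    rw [norm_mul, Real.norm_eq_abs, Real.norm_eq_abs, abs_of_pos (hEpos x)]
    exact mul_le_mul (hW x) (hEle x) (hEpos x).le hB
  have hEb : ∀ x, ‖E x‖ ≤ Real.exp (|s| * B) := fun x => by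
    rw [Real.norm_eq_abs, abs_of_pos (hEpos x)]; exact hEle x
  have hWEm : AEStronglyMeasurable (fun x => W x * E x) μ := (hWm.mul hEm).aestronglyMeasurable
  -- integrability of the four integrands
  have hANi : Integrable (fun x => (mA x : ℝ) * (W x * E x)) μ := hmAi.mul_bdd hWEm (ae_of_all _ hWEb)
  have hAZi : Integrable (fun x => (mA x : ℝ) * E x) μ := hmAi.mul_bdd hEm.aestronglyMeasurable (ae_of_all _ hEb)
  have hBNi : Integrable (fun x => (mB x : ℝ) * (W x * E x)) μ := hmBi.mul_bdd hWEm (ae_of_all _ hWEb)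
  have hBZi : Integrable (fun x => (mB x : ℝ) * E x) μ := hmBi.mul_bdd hEm.aestronglyMeasurable (ae_of_all _ hEb)
  -- names for the four integrals
  set NA := ∫ x, (mA x : ℝ) * (W x * E x) ∂μ with hNA
  set ZA := ∫ x, (mA x : ℝ) * E x ∂μ with hZA
  set NB := ∫ x, (mB x : ℝ) * (W x * E x) ∂μ with hNB
  set ZB := ∫ x, (mB x : ℝ) * E x ∂μ with hZB
  have hZge : ∀ {m : X → ℝ≥0}, Integrable (fun x => (m x : ℝ)) μ → Integrable (fun x => (m x : ℝ) * E x) μ →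
      Real.exp (-(|s| * B)) * ∫ x, (m x : ℝ) ∂μ ≤ ∫ x, (m x : ℝ) * E x ∂μ := by
    intro m hmi hmE
    rw [← integral_const_mul]
    refine integral_mono (hmi.const_mul _) hmE fun x => ?_
    simp only
    rw [mul_comm]
    exact mul_le_mul_of_nonneg_left (hEge x) (m x).coe_nonneg
  have hZApos : 0 < ZA := lt_of_lt_of_le (mul_pos (Real.exp_pos _) hmA0) (hZge hmAi hAZi)
  have hZBge : Real.exp (-(|s| * B)) * ∫ x, (mB x : ℝ) ∂μ ≤ ZB := hZge hmBi hBZi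
  have hZBpos : 0 < ZB := lt_of_lt_of_le (mul_pos (Real.exp_pos _) hmB0) hZBge
  -- the two tilted means as ratios
  have hrat : ∀ {m : X → ℝ≥0}, Measurable m → tiltedMean W (μ.withDensity fun x => m x) s
      = (∫ x, (m x : ℝ) * (W x * E x) ∂μ) / ∫ x, (m x : ℝ) * E x ∂μ := by
    intro m hm
    rw [tiltedMean_eq_div, integral_withDensity_eq_integral_smul hm, integral_withDensity_eq_integral_smul hm]
    simp only [NNReal.smul_def, smul_eq_mul, hEdef]
  have hA : tiltedMean W (μ.withDensity fun x => mA x) s = NA / ZA := hrat hmAm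
  have hB' : tiltedMean W (μ.withDensity fun x => mB x) s = NB / ZB := hrat hmBm
  -- `|q| ≤ B` for `q = NA / ZA`, a tilted mean
  have hq : |NA / ZA| ≤ B := by rw [← hA]; exact abs_tiltedMean_le hW hB s
  -- the exact identity
  have h1 : Integrable (fun x => (mB x : ℝ) * (W x * E x) - NA / ZA * ((mB x : ℝ) * E x)) μ := hBNi.sub (hBZi.const_mul _)
  have h2 : Integrable (fun x => (mB x : ℝ) * (W x * E x) - NA / ZA * ((mB x : ℝ) * E x) - c * ((mA x : ℝ) * (W x * E x))) μ :=
    h1.sub (hANi.const_mul _)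
  have h4 : Integrable (fun x => c * (NA / ZA) * ((mA x : ℝ) * E x)) μ := hAZi.const_mul _
  have hfun : (fun x => ((mB x : ℝ) - c * mA x) * ((W x - NA / ZA) * E x))
      = fun x => (mB x : ℝ) * (W x * E x) - NA / ZA * ((mB x : ℝ) * E x) - c * ((mA x : ℝ) * (W x * E x))
        + c * (NA / ZA) * ((mA x : ℝ) * E x) := by
    funext x; ring
  have hI : Integrable (fun x => ((mB x : ℝ) - c * mA x) * ((W x - NA / ZA) * E x)) μ := by
    rw [hfun]; exact h2.add h4
  have hid : NB / ZB - NA / ZA = (∫ x, ((mB x : ℝ) - c * mA x) * ((W x - NA / ZA) * E x) ∂μ) / ZB := by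
    have hsplit : ∫ x, ((mB x : ℝ) - c * mA x) * ((W x - NA / ZA) * E x) ∂μ
        = NB - NA / ZA * ZB - c * NA + c * (NA / ZA) * ZA := by
      rw [hfun, integral_add h2 h4, integral_sub h1 (hANi.const_mul _), integral_sub hBNi (hBZi.const_mul _),
        integral_const_mul, integral_const_mul, integral_const_mul]
    rw [hsplit]
    field_simp
    ring
  -- the bound on the numerator
  have hnum : |∫ x, ((mB x : ℝ) - c * mA x) * ((W x - NA / ZA) * E x) ∂μ|
      ≤ 2 * B * Real.exp (|s| * B) * ∫ x, |(mB x : ℝ) - c * mA x| ∂μ := by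
    rw [← integral_const_mul]
    refine (abs_integral_le_integral_abs).trans (integral_mono hI.abs
      ((hmBi.sub (hmAi.const_mul c)).abs.const_mul _) fun x => ?_)
    simp only
    rw [abs_mul, abs_mul, abs_of_pos (hEpos x), mul_comm (2 * B * Real.exp (|s| * B))]
    refine mul_le_mul_of_nonneg_left ?_ (abs_nonneg _)
    have h1 : |W x - NA / ZA| ≤ 2 * B := by
      calc |W x - NA / ZA| ≤ |W x| + |NA / ZA| := abs_sub _ _
        _ ≤ B + B := add_le_add (hW x) hq
        _ = 2 * B := by ring
    exact mul_le_mul h1 (hEle x) (hEpos x).le (by linarith)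
  -- assemble
  rw [hB', hA, hid, abs_div, abs_of_pos hZBpos]
  have hexp : Real.exp (2 * (|s| * B)) = Real.exp (|s| * B) / Real.exp (-(|s| * B)) := by
    rw [← Real.exp_sub]; congr 1; ring
  calc |∫ x, ((mB x : ℝ) - c * mA x) * ((W x - NA / ZA) * E x) ∂μ| / ZB
      ≤ (2 * B * Real.exp (|s| * B) * ∫ x, |(mB x : ℝ) - c * mA x| ∂μ) / (Real.exp (-(|s| * B)) * ∫ x, (mB x : ℝ) ∂μ) :=
        div_le_div₀ (by positivity) hnum (mul_pos (Real.exp_pos _) hmB0) hZBge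
    _ = 2 * B * Real.exp (2 * (|s| * B)) * (∫ x, |(mB x : ℝ) - c * mA x| ∂μ) / ∫ x, (mB x : ℝ) ∂μ := by
        rw [hexp]
        field_simp

/-- **ONE WEIGHT: RE-WEIGHTING A LAW MOVES A TILTED MEAN BY AT MOST `2B·e^{2|s|B}` × THE L¹-VISIBILITY OF THE WEIGHT.**  `μ` finite on
`X`, `|W| ≤ B`, `m : X → ℝ≥0` measurable, `μ`-integrable, of positive mass.  For EVERY tilt `s` and EVERY reference level `c`:
`|tiltedMean W (μ.withDensity m) s − tiltedMean W μ s| ≤ 2B·e^{2|s|B}·(∫ |m − c| dμ) ∕ (∫ m dμ)` — the two-weight theorem with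
`mA = 1`; with `c` the mean weight the right side is `2B·e^{2|s|B}` × the total-variation distance of the normalised laws. [folklore] -/
theorem abs_tiltedMean_withDensity_sub_le (hWm : Measurable W) (hW : ∀ x, |W x| ≤ B) {m : X → ℝ≥0}
    (hmm : Measurable m) (hmi : Integrable (fun x => (m x : ℝ)) μ) (hm0 : 0 < ∫ x, (m x : ℝ) ∂μ) (s c : ℝ) :
    |tiltedMean W (μ.withDensity fun x => m x) s - tiltedMean W μ s|
      ≤ 2 * B * Real.exp (2 * (|s| * B)) * (∫ x, |(m x : ℝ) - c| ∂μ) / ∫ x, (m x : ℝ) ∂μ := by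
  have hμ : μ ≠ 0 := by
    intro h; rw [h, integral_zero_measure] at hm0; exact lt_irrefl _ hm0
  have h1i : Integrable (fun _ : X => ((1 : ℝ≥0) : ℝ)) μ := integrable_const _
  have h10 : 0 < ∫ _ : X, ((1 : ℝ≥0) : ℝ) ∂μ := by
    rw [integral_const, smul_eq_mul, NNReal.coe_one, mul_one]
    exact (ENNReal.toReal_pos (Measure.measure_univ_ne_zero.mpr hμ) (measure_ne_top μ _))
  have h := abs_tiltedMean_withDensity_sub_withDensity_le (μ := μ) hWm hW measurable_const h1i h10 hmm hmi hm0 s c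
  have hone : (μ.withDensity fun _ : X => ((1 : ℝ≥0) : ℝ≥0∞)) = μ := by
    rw [ENNReal.coe_one]; exact withDensity_one
  simpa only [hone, NNReal.coe_one, mul_one] using h

end OneSpace

/-! ## §2 Through the unit lattice: the influence of a re-weighting on `W ∘ π` is the influence of a TILT-FREE unit-lattice weight -/

section UnitLattice

variable {Ω X : Type*} {mΩ : MeasurableSpace Ω} {mX : MeasurableSpace X} {π : Ω → X} {ν : Measure Ω} [IsFiniteMeasure ν]
  {r : Ω → ℝ≥0} {W : X → ℝ} {B : ℝ}

/-- **A UNIT-LATTICE VERSION OF THE CONDITIONAL EXPECTATION OF THE WEIGHT EXISTS.**  `π : Ω → X` measurable (in the application: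
the `K`-fold block averaging `avg^K` to the unit-lattice field space), `ν` finite, `r : Ω → ℝ≥0` measurable with `∫⁻ r dν < ∞` (the
density ratio of a re-sampled slot).  Then there is a measurable `m : X → ℝ≥0` with `(ν.map π).withDensity m = (ν.withDensity r).map π`
— a version of `E_ν[r | π]` read on `X` (Radon–Nikodym: the push-forward of `r·ν` is absolutely continuous w.r.t. that of `ν`).  It
depends on `ν`, `r`, `π` only: NO observable, NO tilt, NO source. [folklore] -/
theorem exists_unitLattice_weight (hπ : Measurable π) (hri : ∫⁻ ω, r ω ∂ν ≠ ∞) :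
    ∃ m : X → ℝ≥0, Measurable m ∧
      (ν.map π).withDensity (fun x => (m x : ℝ≥0∞)) = (ν.withDensity fun ω => (r ω : ℝ≥0∞)).map π := by
  haveI : IsFiniteMeasure (ν.withDensity fun ω => (r ω : ℝ≥0∞)) := isFiniteMeasure_withDensity hri
  set μ' := (ν.withDensity fun ω => (r ω : ℝ≥0∞)).map π with hμ'
  set μX := ν.map π with hμX
  haveI : IsFiniteMeasure μ' := Measure.isFiniteMeasure_map _ _
  haveI : IsFiniteMeasure μX := Measure.isFiniteMeasure_map _ _
  have hac : μ' ≪ μX := (withDensity_absolutelyContinuous ν _).map hπ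
  refine ⟨fun x => (μ'.rnDeriv μX x).toNNReal, (Measure.measurable_rnDeriv μ' μX).ennreal_toNNReal, ?_⟩
  have hae : (fun x => ((μ'.rnDeriv μX x).toNNReal : ℝ≥0∞)) =ᵐ[μX] μ'.rnDeriv μX := by
    filter_upwards [Measure.rnDeriv_lt_top μ' μX] with x hx
    exact ENNReal.coe_toNNReal hx.ne
  rw [withDensity_congr_ae hae, Measure.withDensity_rnDeriv_eq μ' μX hac]

omit [IsFiniteMeasure ν] in
/-- **THE INFLUENCE PASSES TO THE UNIT LATTICE WITH A TILT-FREE WEIGHT.**  For `F = W ∘ π` (`W` measurable, `|W| ≤ B`) and a unit-lattice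
version `m` of the weight (`(ν.map π).withDensity m = (ν.withDensity r).map π`):
`tiltedMean (W ∘ π) (ν.withDensity r) s = tiltedMean W ((ν.map π).withDensity m) s` and `tiltedMean (W ∘ π) ν s = tiltedMean W (ν.map π) s`
(gen 2's `tiltedMean_comp_eq`).  The tilt `e^{sW}` lives on `X`; the weight `m` does not know `s`. [folklore] -/
theorem tiltedMean_comp_withDensity_eq (hπ : Measurable π) (hWm : Measurable W) (hW : ∀ x, |W x| ≤ B)
    (hri : ∫⁻ ω, r ω ∂ν ≠ ∞) {m : X → ℝ≥0}
    (hm : (ν.map π).withDensity (fun x => (m x : ℝ≥0∞)) = (ν.withDensity fun ω => (r ω : ℝ≥0∞)).map π) (s : ℝ) :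
    tiltedMean (W ∘ π) (ν.withDensity fun ω => (r ω : ℝ≥0∞)) s = tiltedMean W ((ν.map π).withDensity fun x => (m x : ℝ≥0∞)) s := by
  haveI : IsFiniteMeasure (ν.withDensity fun ω => (r ω : ℝ≥0∞)) := isFiniteMeasure_withDensity hri
  rw [tiltedMean_comp_eq hπ hWm hW, hm]

omit [IsFiniteMeasure ν] in
/-- The unit-lattice weight has the total mass of the re-weighting: `∫ m d(ν.map π) = ∫ r dν`. [folklore] -/
theorem integral_unitLattice_weight_eq (hπ : Measurable π) (hr : Measurable r) {m : X → ℝ≥0}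
    (hmm : Measurable m) (hm : (ν.map π).withDensity (fun x => (m x : ℝ≥0∞)) = (ν.withDensity fun ω => (r ω : ℝ≥0∞)).map π) :
    ∫ x, (m x : ℝ) ∂(ν.map π) = ∫ ω, (r ω : ℝ) ∂ν := by
  have h1 : ∫⁻ x, (m x : ℝ≥0∞) ∂(ν.map π) = ∫⁻ ω, (r ω : ℝ≥0∞) ∂ν := by
    rw [← setLIntegral_univ, ← withDensity_apply _ MeasurableSet.univ, hm, Measure.map_apply hπ MeasurableSet.univ,
      Set.preimage_univ, withDensity_apply _ MeasurableSet.univ, setLIntegral_univ]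
  have hmR : ∫ x, (m x : ℝ) ∂(ν.map π) = (∫⁻ x, (m x : ℝ≥0∞) ∂(ν.map π)).toReal := by
    rw [← integral_toReal hmm.coe_nnreal_ennreal.aemeasurable (ae_of_all _ fun x => ENNReal.coe_lt_top)]
    simp only [ENNReal.coe_toReal]
  have hrR : ∫ ω, (r ω : ℝ) ∂ν = (∫⁻ ω, (r ω : ℝ≥0∞) ∂ν).toReal := by
    rw [← integral_toReal hr.coe_nnreal_ennreal.aemeasurable (ae_of_all _ fun x => ENNReal.coe_lt_top)]
    simp only [ENNReal.coe_toReal]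
  rw [hmR, hrR, h1]

/-- A measurable `ℝ≥0`-weight of finite `lintegral` is integrable as a real function. [folklore] -/
theorem integrable_coe_of_lintegral_ne_top {Y : Type*} {mY : MeasurableSpace Y} {μ : Measure Y} {m : Y → ℝ≥0}
    (hmm : Measurable m) (h : ∫⁻ x, (m x : ℝ≥0∞) ∂μ ≠ ∞) : Integrable (fun x => (m x : ℝ)) μ :=
  ⟨hmm.coe_nnreal_real.aestronglyMeasurable, hasFiniteIntegral_iff_ofNNReal.mpr (lt_top_iff_ne_top.mpr h)⟩

/-- **THE PER-SLOT PRODUCER INPUT, TILT-FREE AND OBSERVABLE-FREE.**  `π : Ω → X` measurable, `ν` finite on `Ω`, `W : X → ℝ`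
measurable with `|W| ≤ B`, `r : Ω → ℝ≥0` a measurable weight with `0 < ∫ r dν < ∞` (re-sampled law `ν.withDensity r`), and `m` ANY
unit-lattice version of the weight (`(ν.map π).withDensity m = (ν.withDensity r).map π`, which exists by `exists_unitLattice_weight`).
Then for EVERY tilt `s` and EVERY reference level `c`:
`|tiltedMean (W ∘ π) (ν.withDensity r) s − tiltedMean (W ∘ π) ν s| ≤ 2B·e^{2|s|B}·(∫ |m − c| d(ν.map π)) ∕ (∫ r dν)`.
The right-hand side — the L¹-VISIBILITY of the re-weighting from the unit lattice — contains NO tilt and NO observable beyond the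
letter `B`: over the window `|s| ≤ l₀` the source costs the constant `e^{2l₀B}` and nothing else.  Reading (gen 4 §5): the influence
is `Cov_{ν_s}(W ∘ π, r) ∕ E_{ν_s}[r]`, and conditioning on `π` replaces `r` by the `s`-INDEPENDENT `m`, because the tilt factor
`e^{sW∘π}` is `π`-measurable. [folklore] -/
theorem abs_influence_comp_le_visibility (hπ : Measurable π) (hWm : Measurable W) (hW : ∀ x, |W x| ≤ B)
    (hr : Measurable r) (hri : ∫⁻ ω, r ω ∂ν ≠ ∞) (hr0 : 0 < ∫ ω, (r ω : ℝ) ∂ν) {m : X → ℝ≥0} (hmm : Measurable m)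
    (hm : (ν.map π).withDensity (fun x => (m x : ℝ≥0∞)) = (ν.withDensity fun ω => (r ω : ℝ≥0∞)).map π) (s c : ℝ) :
    |tiltedMean (W ∘ π) (ν.withDensity fun ω => (r ω : ℝ≥0∞)) s - tiltedMean (W ∘ π) ν s|
      ≤ 2 * B * Real.exp (2 * (|s| * B)) * (∫ x, |(m x : ℝ) - c| ∂(ν.map π)) / ∫ ω, (r ω : ℝ) ∂ν := by
  haveI : IsFiniteMeasure (ν.map π) := Measure.isFiniteMeasure_map _ _
  haveI : IsFiniteMeasure (ν.withDensity fun ω => (r ω : ℝ≥0∞)) := isFiniteMeasure_withDensity hri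
  haveI : IsFiniteMeasure ((ν.withDensity fun ω => (r ω : ℝ≥0∞)).map π) := Measure.isFiniteMeasure_map _ _
  have hmass := integral_unitLattice_weight_eq hπ hr hmm hm
  have hfin : ∫⁻ x, (m x : ℝ≥0∞) ∂(ν.map π) ≠ ∞ := by
    rw [← setLIntegral_univ, ← withDensity_apply _ MeasurableSet.univ, hm]
    exact measure_ne_top _ _
  have hmi : Integrable (fun x => (m x : ℝ)) (ν.map π) := integrable_coe_of_lintegral_ne_top hmm hfin
  have hm0 : 0 < ∫ x, (m x : ℝ) ∂(ν.map π) := by rw [hmass]; exact hr0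
  rw [tiltedMean_comp_withDensity_eq hπ hWm hW hri hm, tiltedMean_comp_eq hπ hWm hW, ← hmass]
  exact abs_tiltedMean_withDensity_sub_le hWm hW hmm hmi hm0 s c

/-- **AN INVISIBLE RE-WEIGHTING HAS NO INFLUENCE** (the `T4Spectator` ∕ ℝ-transparency case, NE1.md R4, in this currency): if the
push-forward of the re-weighted law is a CONSTANT multiple of the push-forward — the weight is invisible from the unit lattice, a
constant `c₀` is a unit-lattice version of it — then every tilted mean of `W ∘ π` is unchanged. [folklore] -/
theorem tiltedMean_comp_withDensity_eq_of_invisible (hπ : Measurable π) (hWm : Measurable W) (hW : ∀ x, |W x| ≤ B)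
    (hr : Measurable r) (hri : ∫⁻ ω, r ω ∂ν ≠ ∞) (hr0 : 0 < ∫ ω, (r ω : ℝ) ∂ν) {c₀ : ℝ≥0}
    (hm : (ν.map π).withDensity (fun _ => (c₀ : ℝ≥0∞)) = (ν.withDensity fun ω => (r ω : ℝ≥0∞)).map π) (s : ℝ) :
    tiltedMean (W ∘ π) (ν.withDensity fun ω => (r ω : ℝ≥0∞)) s = tiltedMean (W ∘ π) ν s := by
  have h := abs_influence_comp_le_visibility hπ hWm hW hr hri hr0 measurable_const hm s (c₀ : ℝ)
  simp only [sub_self, abs_zero, integral_zero, mul_zero, zero_div] at h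
  exact sub_eq_zero.mp (abs_nonpos_iff.mp h)

end UnitLattice

/-! ## §3 The ledger level: a TILT-FREE visibility ledger with geometric slice sums gives `OldInfluenceBudget` -/

section Ledger

variable {ι D : Type*} [DecidableEq ι] {l₀ vol : ℝ} {T : ℕ → Finset ι} {Bad : ℕ → ℝ → Finset ι}
  {wf : ℕ → ι → Finset D} {sc : ℕ → D → ℕ} {Δ : ℕ → ℝ → ι → ℝ → D → ℝ}

/-- **VISIBILITY LEDGER ⇒ `OldInfluenceBudget`.**  If on every good class and every tilt `|s| ≤ l₀` each slot's influence is at most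
`Cv · vis K τ X` with a visibility `vis` that knows NEITHER the source `t` NOR the tilt `s` (§2: `Cv = 2B·e^{2l₀B}`, `vis` = the
unit-lattice L¹-visibility of the slot's weight over its mass), `0 ≤ Cv`, and the scale-`j` slice sums of the visibilities are at most
`vol·E·a^{K−j}`, then gen 3's one-run budget holds: `OldInfluenceBudget l₀ T Bad wf sc Δ vol (Cv·E) a`.  One visibility ledger per
run serves EVERY bounded unit-lattice observable and EVERY tilt window at once. [folklore] -/
theorem oldInfluenceBudget_of_visibility {vis : ℕ → ι → D → ℝ} {Cv E a : ℝ} (hCv : 0 ≤ Cv)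
    (hΔ : ∀ K (t : ℝ), |t| ≤ l₀ → ∀ τ ∈ T K \ Bad K t, ∀ s : ℝ, |s| ≤ l₀ → ∀ X ∈ wf K τ, |Δ K t τ s X| ≤ Cv * vis K τ X)
    (hvis : ∀ K (τ : ι), ∀ j ≤ K, ∑ X ∈ wf K τ with sc K X = j, vis K τ X ≤ vol * (E * a ^ (K - j))) :
    OldInfluenceBudget l₀ T Bad wf sc Δ vol (Cv * E) a := by
  intro K t ht τ hτ s hs j hj
  calc ∑ X ∈ wf K τ with sc K X = j, |Δ K t τ s X - 0|
      ≤ ∑ X ∈ wf K τ with sc K X = j, Cv * vis K τ X :=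
        sum_le_sum fun X hX => by rw [sub_zero]; exact hΔ K t ht τ hτ s hs X (mem_filter.mp hX).1
    _ = Cv * ∑ X ∈ wf K τ with sc K X = j, vis K τ X := by rw [mul_sum]
    _ ≤ Cv * (vol * (E * a ^ (K - j))) := mul_le_mul_of_nonneg_left (hvis K τ j hj) hCv
    _ = vol * (Cv * E * a ^ (K - j)) := by ring

/-- The constant of §1–§2 on the tilt window: for `|s| ≤ l₀`, `2B·e^{2|s|B} ≤ 2B·e^{2l₀B}` (`0 ≤ B`). [folklore] -/
theorem visibilityConst_mono {B l₀ s : ℝ} (hB : 0 ≤ B) (hs : |s| ≤ l₀) :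
    2 * B * Real.exp (2 * (|s| * B)) ≤ 2 * B * Real.exp (2 * (l₀ * B)) :=
  mul_le_mul_of_nonneg_left (Real.exp_le_exp.mpr (by nlinarith [abs_nonneg s])) (by linarith)

end Ledger

/-! ## §4 Switching the slots on one at a time: the one-run chain is controlled by the sum of the UNTILTED visibilities -/

section Chain

variable {Ω X : Type*} {mΩ : MeasurableSpace Ω} {mX : MeasurableSpace X} {π : Ω → X} {W : X → ℝ} {B : ℝ}

/-- TELESCOPING (the `ScaleLedger` of ONE run by construction): along any finite chain of laws `ν 0, ν 1, …, ν n` (in the application: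
the class law with the slots switched on one at a time, in any fixed order — by age, say) the tilted mean under `ν n` is the tilted
mean under `ν 0` (the BASE) plus the sum of the successive influences. [folklore] -/
theorem tiltedMean_telescope (F : Ω → ℝ) (ν : ℕ → Measure Ω) (s : ℝ) (n : ℕ) :
    tiltedMean F (ν n) s = tiltedMean F (ν 0) s + ∑ i ∈ range n, (tiltedMean F (ν (i + 1)) s - tiltedMean F (ν i) s) := by
  have h := Finset.sum_range_sub (fun i => tiltedMean F (ν i) s) n
  linarith

/-- **THE ONE-RUN CHAIN IN VISIBILITY CURRENCY.**  A chain of finite laws `ν i` on `Ω` in which each step is a re-weighting,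
`ν (i+1) = (ν i).withDensity (r i)` (`r i` measurable, `0 < ∫ r i d(ν i) < ∞`), with unit-lattice versions `m i` of the weights and
reference levels `c i`.  Then for the observable `W ∘ π` (`|W| ≤ B`) and every tilt `s`:
`|tiltedMean (W ∘ π) (ν n) s − tiltedMean (W ∘ π) (ν 0) s| ≤ 2B·e^{2|s|B} · Σ_{i<n} (∫ |m i − c i| d((ν i).map π)) ∕ (∫ r i d(ν i))`
— the whole switch-on chain of ONE run is priced by UNTILTED, OBSERVABLE-FREE visibilities. [folklore] -/
theorem abs_tiltedMean_chain_le_sum_visibility (hπ : Measurable π) (hWm : Measurable W) (hW : ∀ x, |W x| ≤ B)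
    {ν : ℕ → Measure Ω} (hν : ∀ i, IsFiniteMeasure (ν i)) {r : ℕ → Ω → ℝ≥0} (hr : ∀ i, Measurable (r i))
    (hri : ∀ i, ∫⁻ ω, r i ω ∂(ν i) ≠ ∞) (hr0 : ∀ i, 0 < ∫ ω, (r i ω : ℝ) ∂(ν i))
    (hstep : ∀ i, ν (i + 1) = (ν i).withDensity fun ω => (r i ω : ℝ≥0∞)) {m : ℕ → X → ℝ≥0} (hmm : ∀ i, Measurable (m i))
    (hm : ∀ i, ((ν i).map π).withDensity (fun x => (m i x : ℝ≥0∞)) = ((ν i).withDensity fun ω => (r i ω : ℝ≥0∞)).map π)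
    (c : ℕ → ℝ) (s : ℝ) (n : ℕ) :
    |tiltedMean (W ∘ π) (ν n) s - tiltedMean (W ∘ π) (ν 0) s|
      ≤ 2 * B * Real.exp (2 * (|s| * B)) *
        ∑ i ∈ range n, (∫ x, |(m i x : ℝ) - c i| ∂((ν i).map π)) / ∫ ω, (r i ω : ℝ) ∂(ν i) := by
  rw [tiltedMean_telescope (W ∘ π) ν s n, add_sub_cancel_left, mul_sum]
  refine (abs_sum_le_sum_abs _ _).trans (sum_le_sum fun i _ => ?_)
  haveI := hν i
  have h := abs_influence_comp_le_visibility hπ hWm hW (hr i) (hri i) (hr0 i) (hmm i) (hm i) s (c i)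
  rw [← hstep i] at h
  simpa only [mul_div_assoc] using h

end Chain

end Summit.QuantumFields.BalabanUV.T4Continuum.NE1p.TiltedMeanVisibility

end
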